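import Literature.Barriers.HubbardSuperconductivity.SignProblemNPHardProofs
import Literature.Barriers.PneNP.RelativizationSparseProofs
import HarnessLib

/-!
# Discharge of the narrowed barrier `SignProblemNPHardNarrow` (audit 2026-08-15 of Troyer–Wiese 2005)

Sibling proof file of `SignProblemNPHard.lean` (D-0014; announced there in the docstring of
`SignProblemNPHardNarrow`). It proves, sorry-free,

* `SignProblemNPHardNarrow_holds : SignProblemNPHardNarrow`, i.e.
  (1) `SignProblemNPHardOn {p | IsUnitCoupling p.2}` — Troyer–Wiese's theorem in relativised form,
      which is the barrier `SignProblemNPHard` itself (`signProblemNPHard_iff_on`), discharged in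
      `SignProblemNPHardProofs.lean` (`SignProblemNPHard_holds`) [TroyerWiese2005, Letter p. 4];
  (2) for every THIN unit-coupling family `𝒥` (`IsThinUnitFamily 𝒥`: one instance `𝒥 L` per size
      parameter `L`, `L ≤ #spins`, couplings in `{0, ±1}`) an oracle `O`, correct on `Set.range 𝒥`
      in the exact query/answer format of `IsIsingThermalOracle`, with `P^O ⊆ P/poly`;
* the corollaries `NP_subset_PPoly_of_signProblemNPHardOn_range` and
  `PH_eq_SigmaP_two_of_signProblemNPHardOn_range`: the barrier SHAPE on a thin family forces
  `NP ⊆ P/poly`, hence `PH = Σ₂ᵖ` (the tree's Karp–Lipton theorem `karp_lipton_holds`).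

## The argument for (2) (Gottesman–Irani's "one instance per problem size ⇒ trivially in P/poly",
## made precise through Meyer's theorem)

Gottesman–Irani, §2: "If it were instead given in unary, there would only be one instance per
problem size, and the problem would be trivially in P/poly." For the thermal oracle of a thin family
this is realised as follows (all machine-level facts are the tree's):

1. **A canonical correct oracle.** On a query string `x = thermalQuery (𝒥 L) m q` answer with the
   code `encodingIntBool.encode a` of `a = ⌊(q+1) ⟨H⟩_{β=m}⌋` (accuracy `1/(q+1)`,
   `floor_answer_accurate`; `|a| ≤ (q+1) n² + 1`, `natAbs_floor_answer_le` with
   `abs_isingThermalEnergy_le`), on every other string with `encodeNat 0`. The query format is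
   injective (`thermalQuery_inj`), so this is a well-defined FUNCTION oracle `Oracle.ofFun f`,
   `f x = ⟦answer code⟧₂` (`exists_answerFn`; `encodeNat ∘ bitsToNat` is the identity on the
   canonical numerals `encodingIntBool.encode a`, `encodeNat_bitsToNat_encodingIntBool_encode`).
   Everything below is proved for an arbitrary ANSWER FUNCTION `f` (hypotheses `hf`, `hf₀`).
2. **It is a truth-table transducer over a sparse set.** With the marker set
   `S = {⟨x, 1ⁱ⟩ | bit i of f x is 1}` (hypothesis `hS`) one has
   `Oracle.ofFun f = ttFn id r (norm ∘ sndP) S` (`ofFun_eq_ttFn_marker`: ask the `r(|x|)` bits in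
   order, strip high zeros; `r = X² + X + 5` bounds the bit length of the answers,
   `answerFn_lt_two_pow`, because thermal energies of unit-coupling systems are bounded by `n²`),
   hence `Oracle.ofFun f ∈ FP^S` (`ttFn_mem_FPRel`, `ofFun_mem_FPRel_marker`) and `P^O ⊆ P^S`
   (`OracleAlg.PRel_subset_PRel_of_mem_FPRel`, composition of polynomial-time oracle machines).
3. **The marker set is sparse** (`isSparseLanguage_marker`): a member of length `ℓ` is
   `⟨thermalQuery (𝒥 L) m q, 1ⁱ⟩` with `L ≤ #spins ≤ ℓ` (thinness and `n² ≤ |code ⟨n, J⟩|`,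
   `sq_le_length_encode`), `m, q ≤ ℓ` (unary) and `i` determined by the rest, so there are at
   most `(ℓ+1)³ ≤ ℓ⁷ + 7` of them.
4. **Meyer's theorem** `P^{sparse} ⊆ P/poly` (`PRel_subset_PPoly_of_isSparseLanguage_holds`,
   `RelativizationSparseProofs.lean`, after Schöning §4, (c) → (a)) finishes: `P^O ⊆ P/poly`.

## References

* M. Troyer, U.-J. Wiese, PRL 94 (2005) 170201, arXiv:cond-mat/0408370, Letter p. 4 and
  Conclusions (`TroyerWiese2005`; `lit read paper:arxiv-cond-mat_0408370`, p. 4).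
* D. Gottesman, S. Irani, Theory of Computing 9 (2013) 31–116, §2 (Problems and Results)
  (`GottesmanIrani2013`).
* U. Schöning, *Complexity theory and interaction*, in: The Universal Turing Machine (2nd ed. 1995),
  §4, Theorem (Karp–Lipton 1980; Berman–Hartmanis 1977), (c) → (a), pp. 528–529 (`Schoning1995`).
* R. M. Karp, R. J. Lipton, STOC 1980, Thm. 6.1 (`KarpLipton1980`).
* R. E. Ladner, N. A. Lynch, A. L. Selman, TCS 1 (1975), §3 (truth-table transducers)
  (`LadnerLynchSelman1975`).
-/

noncomputable section

namespace Literature.Barriers.HubbardSuperconductivity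

open _root_.Computability Literature.Computability.Complexity
  Literature.Computability.Complexity.Nondeterministic Literature.Barriers.PneNP Finset Polynomial

/-! ### (1) The barrier conjunct -/

/-- **Conjunct (1)**: the barrier shape on the full unit-coupling family is the barrier
`SignProblemNPHard` itself, discharged in `SignProblemNPHardProofs.lean`.
[cite: TroyerWiese2005, abstract and Letter p. 4] -/
theorem signProblemNPHardOn_unitCoupling : SignProblemNPHardOn {p | IsUnitCoupling p.2} :=
  signProblemNPHard_iff_on.1 SignProblemNPHard_holds

/-! ### Queries: injectivity and lengths -/

/-- `|1ᵐ| = m`. [folklore] -/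
private theorem length_unaryEncodeNat : ∀ m : ℕ, (unaryEncodeNat m).length = m
  | 0 => rfl
  | m + 1 => by rw [unaryEncodeNat, List.length_cons, length_unaryEncodeNat m]

/-- **The query format is injective**: `⟨code p, ⟨1ᵐ, 1^q⟩⟩` determines `p`, `m` and `q`
(`boolPair` is a pairing, encodings are injective). [cite: AroraBarak2009, §0.1] -/
theorem thermalQuery_inj {p p' : Σ n, Matrix (Fin n) (Fin n) ℤ} {m q m' q' : ℕ}
    (h : thermalQuery p m q = thermalQuery p' m' q') : p = p' ∧ m = m' ∧ q = q' := by
  have h1 : (encodingIntMatrix.encode p, boolPair (unaryEncodeNat m) (unaryEncodeNat q)) =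
      (encodingIntMatrix.encode p', boolPair (unaryEncodeNat m') (unaryEncodeNat q')) :=
    boolPair_injective (show Function.uncurry boolPair (_, _) = Function.uncurry boolPair (_, _) from h)
  obtain ⟨hp, hmq⟩ := Prod.mk.inj h1
  have h2 : (unaryEncodeNat m, unaryEncodeNat q) = (unaryEncodeNat m', unaryEncodeNat q') :=
    boolPair_injective (show Function.uncurry boolPair (_, _) = Function.uncurry boolPair (_, _) from hmq)
  obtain ⟨hm, hq⟩ := Prod.mk.inj h2
  -- unary numerals are injective (decode them)
  have hu : ∀ {a b : ℕ}, unaryEncodeNat a = unaryEncodeNat b → a = b := fun hab => by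
    have h' := congrArg unaryDecodeNat hab
    rwa [unary_decode_encode_nat, unary_decode_encode_nat] at h'
  exact ⟨encodingIntMatrix.encode_injective hp, hu hm, hu hq⟩

/-- Length of a query: `|⟨code p, ⟨1ᵐ, 1^q⟩⟩| = 2 |code p| + 2 + (2m + 2 + q)`. [cite: AroraBarak2009, §0.1] -/
theorem length_thermalQuery (p : Σ n, Matrix (Fin n) (Fin n) ℤ) (m q : ℕ) :
    (thermalQuery p m q).length =
      2 * (encodingIntMatrix.encode p).length + 2 + (2 * m + 2 + q) := by
  rw [thermalQuery, length_boolPair, length_boolPair, length_unaryEncodeNat, length_unaryEncodeNat]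

/-- The list code of `l` has length `≥ 2|l| + 2` (its unary length header, doubled).
[cite: AroraBarak2009, §0.1] -/
private theorem length_listBool_encode (l : List ℤ) :
    2 * l.length + 2 ≤ (encodingIntBool.listBool.encode l).length := by
  change 2 * l.length + 2 ≤ (boolPair (unaryEncodeNat l.length)
    (l.foldr (fun a acc => boolPair (encodingIntBool.encode a) acc) [])).length
  rw [length_boolPair, length_unaryEncodeNat]
  omega

/-- **The matrix code is at least quadratic in the dimension**: `2 n² + 2 ≤ |code ⟨n, J⟩|`
(the row-major entry list has `n²` entries and a unary length header). [cite: AroraBarak2009, §0.1] -/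
theorem sq_le_length_encode (p : Σ n, Matrix (Fin n) (Fin n) ℤ) :
    2 * (p.1 * p.1) + 2 ≤ (encodingIntMatrix.encode p).length := by
  rw [encodingIntMatrix_encode, length_boolPair]
  have key : 2 * (p.1 * p.1) + 2 ≤
      ((Literature.Algebra.EuclideanLattices.encodingIntMatrixFin p.1).encode p.2).length := by
    simp only [Literature.Algebra.EuclideanLattices.encodingIntMatrixFin, Encoding.ofEquiv_encode,
      encodingFinVec]
    refine le_trans ?_ (length_listBool_encode _)
    rw [List.length_ofFn]
  omega

/-! ### Energies are bounded by `n²` -/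

/-- `|E_J(σ)| ≤ n²` for unit couplings (at most `n²` terms of modulus `≤ 1`). [cite: TroyerWiese2005, Letter p. 4] -/
theorem abs_isingEnergy_le {n : ℕ} {J : Matrix (Fin n) (Fin n) ℤ} (hJ : IsUnitCoupling J)
    (σ : Fin n → Bool) : |isingEnergy J σ| ≤ n * n := by
  unfold isingEnergy
  rw [abs_neg]
  have hs : ∀ k, |spinSign σ k| = 1 := fun k => by unfold spinSign; split_ifs <;> simp
  calc |∑ i, ∑ j, (if i < j then J i j * spinSign σ i * spinSign σ j else 0)|
      ≤ ∑ i, |∑ j, (if i < j then J i j * spinSign σ i * spinSign σ j else 0)| :=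
        Finset.abs_sum_le_sum_abs _ _
    _ ≤ ∑ i, ∑ j, |(if i < j then J i j * spinSign σ i * spinSign σ j else 0)| :=
        Finset.sum_le_sum fun i _ => Finset.abs_sum_le_sum_abs _ _
    _ ≤ ∑ _i : Fin n, ∑ _j : Fin n, (1 : ℤ) := by
        refine Finset.sum_le_sum fun i _ => Finset.sum_le_sum fun j _ => ?_
        split_ifs
        · have hJ1 : |J i j| ≤ 1 := by rcases hJ i j with h | h | h <;> simp [h]
          rw [abs_mul, abs_mul, hs, hs, mul_one, mul_one]
          exact hJ1
        · simp
    _ = n * n := by simp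

/-- `|⟨H_J⟩_β| ≤ n²`: a thermal average of energies of modulus `≤ n²`. [cite: TroyerWiese2005, Letter p. 2, eq. (1)] -/
theorem abs_isingThermalEnergy_le {n : ℕ} {J : Matrix (Fin n) (Fin n) ℤ} (hJ : IsUnitCoupling J)
    (β : ℝ) : |isingThermalEnergy J β| ≤ n * n := by
  have hZ := isingPartitionFunction_pos J β
  unfold isingThermalEnergy
  rw [abs_div, abs_of_pos hZ, div_le_iff₀ hZ]
  unfold isingPartitionFunction
  rw [Finset.mul_sum]
  refine (Finset.abs_sum_le_sum_abs _ _).trans (Finset.sum_le_sum fun σ _ => ?_)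
  rw [abs_mul, abs_of_pos (Real.exp_pos _)]
  refine mul_le_mul_of_nonneg_right ?_ (Real.exp_pos _).le
  exact_mod_cast abs_isingEnergy_le hJ σ

/-! ### Accurate bounded integer answers and their codes -/

/-- The floor answer `a = ⌊(q+1) E⌋` has the accuracy `1/(q+1)` required by
`IsIsingThermalOracleOn`: `|a/(q+1) - E| ≤ 1/(q+1)`. [folklore] -/
theorem floor_answer_accurate (E : ℝ) (q : ℕ) :
    |((⌊((q : ℝ) + 1) * E⌋ : ℤ) : ℝ) / (q + 1) - E| ≤ 1 / (q + 1) := by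
  have hc : (0 : ℝ) < (q : ℝ) + 1 := by positivity
  have h1 : ((⌊((q : ℝ) + 1) * E⌋ : ℤ) : ℝ) ≤ ((q : ℝ) + 1) * E := Int.floor_le _
  have h2 : ((q : ℝ) + 1) * E < ((⌊((q : ℝ) + 1) * E⌋ : ℤ) : ℝ) + 1 := Int.lt_floor_add_one _
  have key : |((⌊((q : ℝ) + 1) * E⌋ : ℤ) : ℝ) - ((q : ℝ) + 1) * E| ≤ 1 :=
    abs_sub_le_iff.2 ⟨by linarith, by linarith⟩
  have hre : ((⌊((q : ℝ) + 1) * E⌋ : ℤ) : ℝ) / (q + 1) - E =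
      (((⌊((q : ℝ) + 1) * E⌋ : ℤ) : ℝ) - ((q : ℝ) + 1) * E) / ((q : ℝ) + 1) := by
    field_simp
  rw [hre, abs_div, abs_of_pos hc]
  exact div_le_div_of_nonneg_right key hc.le

/-- `|⌊(q+1) E⌋| ≤ (q+1) N + 1` when `|E| ≤ N`. [folklore] -/
theorem natAbs_floor_answer_le {E : ℝ} {N : ℕ} (hE : |E| ≤ N) (q : ℕ) :
    (⌊((q : ℝ) + 1) * E⌋).natAbs ≤ (q + 1) * N + 1 := by
  obtain ⟨hE1, hE2⟩ := abs_le.1 hE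
  have hc : (0 : ℝ) ≤ (q : ℝ) + 1 := by positivity
  have h1 : ((⌊((q : ℝ) + 1) * E⌋ : ℤ) : ℝ) ≤ ((q : ℝ) + 1) * E := Int.floor_le _
  have h2 : ((q : ℝ) + 1) * E < ((⌊((q : ℝ) + 1) * E⌋ : ℤ) : ℝ) + 1 := Int.lt_floor_add_one _
  have h3 : ((q : ℝ) + 1) * E ≤ ((q : ℝ) + 1) * N := mul_le_mul_of_nonneg_left hE2 hc
  have h4 : ((q : ℝ) + 1) * -(N : ℝ) ≤ ((q : ℝ) + 1) * E := mul_le_mul_of_nonneg_left hE1 hc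
  have key : |((⌊((q : ℝ) + 1) * E⌋ : ℤ) : ℝ)| ≤ ((q : ℝ) + 1) * N + 1 :=
    abs_le.2 ⟨by linarith, by linarith⟩
  have key' : ((⌊((q : ℝ) + 1) * E⌋).natAbs : ℝ) ≤ (((q + 1) * N + 1 : ℕ) : ℝ) := by
    rw [Nat.cast_natAbs, Int.cast_abs]
    push_cast
    exact key
  exact_mod_cast key'

/-- The code of an integer, flat: `[s, s, 0, 1] ++ bin |a|` with `s = [a < 0]`. [cite: AroraBarak2009, §0.1] -/
theorem encodingIntBool_encode_eq (a : ℤ) :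
    encodingIntBool.encode a = [decide (a < 0), decide (a < 0), false, true] ++ encodeNat a.natAbs :=
  rfl

/-- The code of an integer is a canonical numeral (it ends in `true`). [folklore] -/
theorem isCanonicalNum_encodingIntBool_encode (a : ℤ) : IsCanonicalNum (encodingIntBool.encode a) := by
  rw [encodingIntBool_encode_eq]
  right
  rcases isCanonicalNum_encodeNat a.natAbs with h | h
  · rw [h]; rfl
  · rw [List.getLast?_append, h]; rfl

/-- **`bin ⟦code a⟧₂ = code a`**: a function oracle `Oracle.ofFun f` whose value on a query is
`⟦code a⟧₂` answers that query with the integer code of `a`. [folklore] -/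
theorem encodeNat_bitsToNat_encodingIntBool_encode (a : ℤ) :
    encodeNat (bitsToNat (encodingIntBool.encode a)) = encodingIntBool.encode a :=
  encodeNat_bitsToNat (isCanonicalNum_encodingIntBool_encode a)

/-- `⟦code a⟧₂ ≤ 11 + 16 |a|`. [folklore] -/
theorem bitsToNat_encodingIntBool_encode_le (a : ℤ) :
    bitsToNat (encodingIntBool.encode a) ≤ 11 + 16 * a.natAbs := by
  rw [encodingIntBool_encode_eq, bitsToNat_append, bitsToNat_encodeNat]
  cases decide (a < 0) <;> simp

/-! ### Answer functions of a thin family: correct, polynomially bounded, transducers over a sparse set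

An ANSWER FUNCTION of the family `𝒥` is any `f : {0,1}* → ℕ` whose value on a query string
`thermalQuery (𝒥 L) m q` is `⟦code a⟧₂` for an integer `a` within `1/(q+1)` of
`(q+1) ⟨H⟩_{β=m}` and of modulus `≤ (q+1) n² + 1`, and which vanishes on all other strings
(hypotheses `hf`, `hf₀` below; `exists_answerFn`: the floor answers give one). A MARKER SET for `f`
is the language `S = {⟨x, 1ⁱ⟩ | bit i of f x is 1}` (hypothesis `hS`; it is written out in the
final assembly). -/

section Family

variable {𝒥 : ℕ → Σ n, Matrix (Fin n) (Fin n) ℤ} {f : List Bool → ℕ} {S : Language Bool}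

variable (h𝒥 : IsThinUnitFamily 𝒥)
  (hf : ∀ L m q : ℕ, ∃ a : ℤ, encodeNat (f (thermalQuery (𝒥 L) m q)) = encodingIntBool.encode a ∧
    |(a : ℝ) / (q + 1) - isingThermalEnergy (𝒥 L).2 m| ≤ 1 / (q + 1) ∧
      a.natAbs ≤ (q + 1) * ((𝒥 L).1 * (𝒥 L).1) + 1)
  (hf₀ : ∀ x : List Bool, (¬ ∃ L m q : ℕ, x = thermalQuery (𝒥 L) m q) → f x = 0)
  (hS : ∀ z : List Bool, z ∈ S ↔
    z = boolPair (fstP z) (List.replicate (sndP z).length true) ∧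
      (f (fstP z)).testBit (sndP z).length = true)

include h𝒥 in
/-- **Existence of an answer function**: answer the query `(𝒥 L, m, q)` with the floor answer
`⌊(q+1) ⟨H_{(𝒥 L).2}⟩_{β=m}⌋` (well defined on strings by `thermalQuery_inj`; accuracy
`floor_answer_accurate`, size `natAbs_floor_answer_le` with `abs_isingThermalEnergy_le`), and every
other string with `0`. [cite: GottesmanIrani2013, §2 (Problems and Results)] -/
theorem exists_answerFn :
    ∃ f : List Bool → ℕ,
      (∀ L m q : ℕ, ∃ a : ℤ, encodeNat (f (thermalQuery (𝒥 L) m q)) = encodingIntBool.encode a ∧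
        |(a : ℝ) / (q + 1) - isingThermalEnergy (𝒥 L).2 m| ≤ 1 / (q + 1) ∧
          a.natAbs ≤ (q + 1) * ((𝒥 L).1 * (𝒥 L).1) + 1) ∧
      ∀ x : List Bool, (¬ ∃ L m q : ℕ, x = thermalQuery (𝒥 L) m q) → f x = 0 := by
  classical
  refine ⟨fun x => if h : ∃ L m q : ℕ, x = thermalQuery (𝒥 L) m q then
      bitsToNat (encodingIntBool.encode
        ⌊((h.choose_spec.choose_spec.choose : ℝ) + 1) *
          isingThermalEnergy (𝒥 h.choose).2 h.choose_spec.choose⌋) else 0,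
    fun L m q => ?_, fun x hx => dif_neg hx⟩
  have h : ∃ L' m' q' : ℕ, thermalQuery (𝒥 L) m q = thermalQuery (𝒥 L') m' q' := ⟨L, m, q, rfl⟩
  have hE : |isingThermalEnergy (𝒥 L).2 m| ≤ (((𝒥 L).1 * (𝒥 L).1 : ℕ) : ℝ) := by
    push_cast
    exact abs_isingThermalEnergy_le (h𝒥.2 L) _
  refine ⟨⌊((q : ℝ) + 1) * isingThermalEnergy (𝒥 L).2 m⌋, ?_, floor_answer_accurate _ q,
    natAbs_floor_answer_le hE q⟩
  have key : ∀ (p' : Σ n, Matrix (Fin n) (Fin n) ℤ) (m' q' : ℕ),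
      thermalQuery (𝒥 L) m q = thermalQuery p' m' q' →
        ⌊((q' : ℝ) + 1) * isingThermalEnergy p'.2 m'⌋ =
          ⌊((q : ℝ) + 1) * isingThermalEnergy (𝒥 L).2 m⌋ := by
    intro p' m' q' hx
    obtain ⟨rfl, rfl, rfl⟩ := thermalQuery_inj hx
    rfl
  dsimp only
  rw [dif_pos h, key _ _ _ h.choose_spec.choose_spec.choose_spec,
    encodeNat_bitsToNat_encodingIntBool_encode]

include hf in
/-- **An answer function gives a CORRECT oracle on the family**, in the exact format of
`IsIsingThermalOracle`. [cite: TroyerWiese2005, Letter p. 3 (definitions)] -/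
theorem isIsingThermalOracleOn_ofFun : IsIsingThermalOracleOn (Set.range 𝒥) (Oracle.ofFun f) := by
  rintro p ⟨L, rfl⟩ m q
  obtain ⟨a, ha, hacc, -⟩ := hf L m q
  exact ⟨a, ha, hacc⟩

/-- The bit-length polynomial `r = X² + X + 5`: `r(ℓ) = ℓ² + ℓ + 5`. [folklore] -/
private theorem eval_rPoly (ℓ : ℕ) : (X * X + X + 5 : Polynomial ℕ).eval ℓ = ℓ * ℓ + ℓ + 5 := by
  simp

include hf hf₀ in
/-- **Answers have polynomial bit length**: `f x < 2^{|x|² + |x| + 5}` (`|a| ≤ (q+1) n² + 1` with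
`q ≤ |x|` and `n² ≤ |x|`, `sq_le_length_encode`). [folklore] -/
theorem answerFn_lt_two_pow (x : List Bool) : f x < 2 ^ (x.length * x.length + x.length + 5) := by
  by_cases hx : ∃ L m q : ℕ, x = thermalQuery (𝒥 L) m q
  · obtain ⟨L, m, q, rfl⟩ := hx
    obtain ⟨a, ha, -, h2⟩ := hf L m q
    have hfa : f (thermalQuery (𝒥 L) m q) = bitsToNat (encodingIntBool.encode a) := by
      rw [← ha, bitsToNat_encodeNat]
    rw [hfa]
    set ℓ := (thermalQuery (𝒥 L) m q).length with hℓ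
    have hlen := length_thermalQuery (𝒥 L) m q
    have hsq := sq_le_length_encode (𝒥 L)
    have hq : q + 1 ≤ ℓ + 1 := by omega
    have hn : (𝒥 L).1 * (𝒥 L).1 ≤ ℓ := by omega
    have h1 := bitsToNat_encodingIntBool_encode_le a
    have h3 : (q + 1) * ((𝒥 L).1 * (𝒥 L).1) ≤ (ℓ + 1) * ℓ := Nat.mul_le_mul hq hn
    have h4 : ℓ * ℓ + ℓ < 2 ^ (ℓ * ℓ + ℓ) := Nat.lt_two_pow_self
    have h5 : 2 ^ (ℓ * ℓ + ℓ + 5) = 2 ^ (ℓ * ℓ + ℓ) * 32 := by rw [pow_add]; norm_num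
    have h6 : (ℓ + 1) * ℓ = ℓ * ℓ + ℓ := by ring
    rw [h5]
    rw [h6] at h3
    omega
  · rw [hf₀ x hx]
    positivity

include hS in
/-- Membership of a marker pair `⟨x, 1ⁱ⟩` in the marker set. [folklore] -/
theorem boolPair_replicate_mem_marker_iff (x : List Bool) (i : ℕ) :
    boolPair x (List.replicate i true) ∈ S ↔ (f x).testBit i = true := by
  rw [hS, fstP_boolPair, sndP_boolPair, List.length_replicate]
  exact ⟨fun h => h.2, fun h => ⟨rfl, h⟩⟩

include hS in
/-- The answer bits of the identity queries against the marker set are the bits of `f x`. [folklore] -/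
theorem ttBits_id_marker (x : List Bool) (r : ℕ) :
    ttBits id S x r = (List.range r).map fun i => (f x).testBit i := by
  simp only [ttBits, id]
  refine List.map_congr_left fun i _ => ?_
  by_cases h : (f x).testBit i = true
  · rw [(Set.mem_iff_boolIndicator _ _).1 ((boolPair_replicate_mem_marker_iff hS x i).2 h), h]
  · rw [(Set.notMem_iff_boolIndicator _ _).1
      (fun h' => h ((boolPair_replicate_mem_marker_iff hS x i).1 h'))]
    exact (Bool.eq_false_iff.2 h).symm

include hf hf₀ hS in
/-- **The oracle of an answer function is a truth-table transducer over its marker set**: ask the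
bits `0, …, r(|x|) - 1` (queries `⟨x, 1ⁱ⟩`) and output the normal form of the answer string.
[cite: LadnerLynchSelman1975, §3] -/
theorem ofFun_eq_ttFn_marker :
    Oracle.ofFun f = ttFn id (X * X + X + 5 : Polynomial ℕ) (norm ∘ sndP) S := by
  funext x
  rw [Oracle.ofFun_apply, ttFn_apply, Function.comp_apply, sndP_boolPair, ttBits_id_marker hS,
    norm_eq_encodeNat, bitsToNat_map_testBit, eval_rPoly,
    Nat.mod_eq_of_lt (answerFn_lt_two_pow hf hf₀ x)]

include hf hf₀ hS in
/-- Hence **the oracle of an answer function is in `FP^S`** for its marker set `S`.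
[cite: LadnerLynchSelman1975, §3] -/
theorem ofFun_mem_FPRel_marker : Oracle.ofFun f ∈ FPRel (Oracle.ofLanguage S) := by
  rw [ofFun_eq_ttFn_marker hf hf₀ hS]
  exact ttFn_mem_FPRel OracleCompose.id_mem_FP (comp_mem_FP Brick.norm_mem_FP sndP_mem_FP) _

/-- `(ℓ + 1)³ ≤ ℓ⁷ + 7`. [folklore] -/
private theorem succ_pow_three_le (ℓ : ℕ) : (ℓ + 1) ^ 3 ≤ ℓ ^ 7 + 7 := by
  rcases Nat.lt_or_ge ℓ 2 with h | h
  · interval_cases ℓ <;> norm_num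
  · have h1 : (ℓ + 1) ^ 3 ≤ (2 * ℓ) ^ 3 := Nat.pow_le_pow_left (by omega) 3
    have h3 : 2 ^ 3 ≤ ℓ ^ 3 := Nat.pow_le_pow_left h 3
    have h4 : 8 * ℓ ^ 3 ≤ ℓ ^ 3 * ℓ ^ 3 := Nat.mul_le_mul_right _ h3
    have h6 : ℓ ^ 6 ≤ ℓ ^ 7 := Nat.pow_le_pow_right (by omega) (by norm_num)
    have h2 : (2 * ℓ) ^ 3 = 8 * ℓ ^ 3 := by ring
    have h5 : ℓ ^ 3 * ℓ ^ 3 = ℓ ^ 6 := by ring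
    omega

include h𝒥 hf₀ hS in
/-- **The marker set of a thin family is sparse**: a member of length `ℓ` is
`⟨thermalQuery (𝒥 L) m q, 1ⁱ⟩` with `L ≤ #spins ≤ ℓ` (thinness and `n² ≤ |code ⟨n, J⟩|`),
`m, q ≤ ℓ` (unary) and `i` determined by `ℓ` and the query, so there are at most
`(ℓ+1)³ ≤ ℓ⁷ + 7` of them ("there would only be one instance per problem size").
[cite: GottesmanIrani2013, §2 (Problems and Results)] -/
theorem isSparseLanguage_marker : IsSparseLanguage S := by
  classical
  refine ⟨7, fun ℓ => ?_⟩
  let g : ℕ × ℕ × ℕ → List Bool := fun t =>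
    boolPair (thermalQuery (𝒥 t.1) t.2.1 t.2.2)
      (List.replicate (ℓ - (2 * (thermalQuery (𝒥 t.1) t.2.1 t.2.2).length + 2)) true)
  let P : Finset (ℕ × ℕ × ℕ) := range (ℓ + 1) ×ˢ (range (ℓ + 1) ×ˢ range (ℓ + 1))
  have hsub : {z : List Bool | z ∈ S ∧ z.length = ℓ} ⊆ ↑(P.image g) := by
    rintro z ⟨hz, hzℓ⟩
    obtain ⟨hzeq, hbit⟩ := (hS z).1 hz
    have hQ : ∃ L m q : ℕ, fstP z = thermalQuery (𝒥 L) m q := by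
      by_contra hQ
      rw [hf₀ _ hQ, Nat.zero_testBit] at hbit
      exact Bool.false_ne_true hbit
    obtain ⟨L, m, q, hx⟩ := hQ
    have hlen := length_thermalQuery (𝒥 L) m q
    have hsq := sq_le_length_encode (𝒥 L)
    have hL := h𝒥.1 L
    have hLL : (𝒥 L).1 ≤ (𝒥 L).1 * (𝒥 L).1 := Nat.le_mul_self _
    have hzlen : z.length = 2 * (fstP z).length + 2 + (sndP z).length := by
      conv_lhs => rw [hzeq]
      rw [length_boolPair, List.length_replicate]
    rw [hx, hzℓ] at hzlen
    rw [Finset.coe_image]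
    refine ⟨(L, m, q), ?_, ?_⟩
    · simp only [Finset.mem_coe, P, Finset.mem_product, Finset.mem_range]
      omega
    · have hi : ℓ - (2 * (thermalQuery (𝒥 L) m q).length + 2) = (sndP z).length := by omega
      change boolPair (thermalQuery (𝒥 L) m q)
          (List.replicate (ℓ - (2 * (thermalQuery (𝒥 L) m q).length + 2)) true) = z
      rw [hi, ← hx]
      exact hzeq.symm
  calc {z : List Bool | z ∈ S ∧ z.length = ℓ}.ncard
      ≤ (↑(P.image g) : Set (List Bool)).ncard := Set.ncard_le_ncard hsub (Finset.finite_toSet _)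
    _ = (P.image g).card := Set.ncard_coe_finset _
    _ ≤ P.card := Finset.card_image_le
    _ = (ℓ + 1) ^ 3 := by simp only [P, Finset.card_product, Finset.card_range]; ring
    _ ≤ ℓ ^ 7 + 7 := succ_pow_three_le ℓ

include h𝒥 in
/-- **Conjunct (2)**: a thin unit-coupling family has a CORRECT thermal oracle relative to which
polynomial time stays inside `P/poly` — the oracle of an answer function (`exists_answerFn`), a
truth-table transducer over its sparse marker set, so `P^O ⊆ P^S` (composition of polynomial-time
oracle machines, `OracleAlg.PRel_subset_PRel_of_mem_FPRel`) and `P^S ⊆ P/poly` by Meyer's theorem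
(`PRel_subset_PPoly_of_isSparseLanguage_holds`).
[cite: Schoning1995, §4, Theorem (Karp–Lipton 1980; Berman–Hartmanis 1977), (c) → (a) (pp. 528–529)]
[cite: GottesmanIrani2013, §2 (Problems and Results)] -/
theorem exists_thermalOracleOn_range_PRel_subset_PPoly :
    ∃ O : Oracle, IsIsingThermalOracleOn (Set.range 𝒥) O ∧ PRel O ⊆ PPoly := by
  obtain ⟨f, hf, hf₀⟩ := exists_answerFn h𝒥
  let S : Language Bool :=
    {z | z = boolPair (fstP z) (List.replicate (sndP z).length true) ∧
      (f (fstP z)).testBit (sndP z).length = true}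
  have hS : ∀ z : List Bool, z ∈ S ↔
      z = boolPair (fstP z) (List.replicate (sndP z).length true) ∧
        (f (fstP z)).testBit (sndP z).length = true := fun z => Iff.rfl
  exact ⟨Oracle.ofFun f, isIsingThermalOracleOn_ofFun hf,
    (OracleAlg.PRel_subset_PRel_of_mem_FPRel (ofFun_mem_FPRel_marker hf hf₀ hS)).trans
      (PRel_subset_PPoly_of_isSparseLanguage_holds (isSparseLanguage_marker h𝒥 hf₀ hS))⟩

end Family

/-! ### The discharge and its corollaries -/

/-- **NARROWED BARRIER `SignProblemNPHardNarrow` — discharged.** (1) Troyer–Wiese's theorem in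
relativised form, `SignProblemNPHardOn {p | IsUnitCoupling p.2}` (`SignProblemNPHard_holds`);
(2) for every thin unit-coupling family `𝒥` a correct thermal oracle `O` on `Set.range 𝒥` with
`P^O ⊆ P/poly` (`exists_thermalOracleOn_range_PRel_subset_PPoly`).
[cite: TroyerWiese2005, Letter p. 4 and Conclusions]
[cite: GottesmanIrani2013, §2 (Problems and Results)]
[cite: Schoning1995, §4, Theorem (Karp–Lipton 1980; Berman–Hartmanis 1977), (c) → (a) (pp. 528–529)] -/
theorem SignProblemNPHardNarrow_holds : SignProblemNPHardNarrow :=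
  ⟨signProblemNPHardOn_unitCoupling, fun _ h𝒥 => exists_thermalOracleOn_range_PRel_subset_PPoly h𝒥⟩

/-- **The barrier shape on a thin family forces `NP ⊆ P/poly`.**
[cite: GottesmanIrani2013, §2 (Problems and Results)] -/
theorem NP_subset_PPoly_of_signProblemNPHardOn_range {𝒥 : ℕ → Σ n, Matrix (Fin n) (Fin n) ℤ}
    (h𝒥 : IsThinUnitFamily 𝒥) (hb : SignProblemNPHardOn (Set.range 𝒥)) : NP ⊆ PPoly :=
  SignProblemNPHardNarrow_holds.NP_subset_PPoly_of_thin h𝒥 hb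

/-- **… and hence collapses the polynomial hierarchy to `Σ₂ᵖ`** (Karp–Lipton, the tree theorem
`karp_lipton_holds`). [cite: KarpLipton1980, Thm. 6.1] -/
theorem PH_eq_SigmaP_two_of_signProblemNPHardOn_range {𝒥 : ℕ → Σ n, Matrix (Fin n) (Fin n) ℤ}
    (h𝒥 : IsThinUnitFamily 𝒥) (hb : SignProblemNPHardOn (Set.range 𝒥)) : PH = SigmaP 2 :=
  karp_lipton_holds (NP_subset_PPoly_of_signProblemNPHardOn_range h𝒥 hb)

/-- In particular for the uniform all-to-all families (non-vacuity of the thin-family clause):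
an `NP`-hardness barrier of this shape for the single-instance-per-size family `L ↦ ⟨L, (c)⟩`,
`c ∈ {0, ±1}`, would collapse `PH`. [cite: GottesmanIrani2013, §2 (Problems and Results)] -/
theorem PH_eq_SigmaP_two_of_signProblemNPHardOn_uniform {c : ℤ} (hc : c = 0 ∨ c = 1 ∨ c = -1)
    (hb : SignProblemNPHardOn
      (Set.range fun L : ℕ => (⟨L, fun _ _ => c⟩ : Σ n, Matrix (Fin n) (Fin n) ℤ))) :
    PH = SigmaP 2 :=
  PH_eq_SigmaP_two_of_signProblemNPHardOn_range (isThinUnitFamily_uniform hc) hb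

end Literature.Barriers.HubbardSuperconductivity

end
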